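import Literature.NumberTheory.EllipticCurves.ShaPTorsionVanishingHigherRank
import Summits.BirchSwinnertonDyer.BirchSwinnertonDyer.Theorems.KolyvaginDepthDoorDepthTableRow794a1TwoShaModRank
import Summits.BirchSwinnertonDyer.BirchSwinnertonDyer.Theorems.KolyvaginDepthDoorKNSupplyExactReading
import HarnessLib

/-!
# Route `KolyvaginDepthDoor`, crux `KolyvaginDepthSupplyKN` (stmt-BirchSwinnertonDyer-22820) —
# DEPTH TABLE v13 (part 8): the UNCERTIFIED curves (generic lemma + `794a1`; `997b1`, `997c1` in part 9) — `Ш(E)[5] = 0` by name needs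
# only `2 ≤ rank`, so the crux's clause at each of them is ALSO one rank-one datum away (no 2-descent certificate needed)

Helper file of the lead prover of line `levelone` (kdd-p1 g17; `--supports stmt-BirchSwinnertonDyer-22820
--as helper`); it closes nothing and BSD is NOT proved by it.

The rows of `794a1`, `997b1`, `997c1` stay «modulo `rank E = 2`» (no kernel 2-descent certificate: observatory
residual classes). But Stein–Wuthrich 2013 Thm. 1.1 asks only for `rank ≥ 2` — which the tree HOLDS for all three
(`KernelCerts002.C794a1.two_le_rank`, `KernelCertsR01.C997b1.two_le_rank`, `KernelCerts003.C997c1.two_le_rank`, two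
independent points in the kernel) — and the crux's first-sign clause asks only for `ν + 1 ≤ rank`. Hence:

* `cruxBody_of_sha_of_twistSelmer_of_lemma84` — **generic, any curve on W. Zhang's ♠ cell**: for `W` globally
  minimal non-CM with `2 ≤ rank`, `p ≥ 5` good ordinary with `ρ_{E,p^∞}` onto and Kodaira–Néron at `p`, ♠ (1) and
  ♠ (2) (in `p`-form), `K` Heegner (`d_K ∉ {−3, −4}`, `p ∤ d_K`), GIVEN `Ш(E/ℚ)[p] = 0` and ONE bound
  `#Sel_p(E^{(d_K)}/ℚ) ≤ p ^ rank E(ℚ)`: the CLAUSE of `KolyvaginDepthSupplyKN` holds at `W` verbatim (witnesses `p`,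
  `K`, the level-one class of W. Zhang's Lemma 8.4 (1) at depth `rank − 1`, first sign) — the per-`(E,p,K)` content
  of the lineage's exact reading (`rankClause_of_structure_of_twistCondition`, g14) in the crux's own wording, modulo
  Zhang's Lemma 8.4 (1) / Thm. 9.1 BY NAME only (no (γ): that is the door direction).
* per curve (`C794a1`, `C997b1`, `C997c1`): `sha_inf_torsionBy_five_eq_bot` (SW Thm. 1.1 by name at the kernel
  certificates), `exactRowZhang_5_neg23_oneTwistModRank` (the v12 «two Ш» row at `d_K = −23` with the `E`-side `Ш`
  conjunct discharged: bit `↔` «`rank E = 2` ∧ `rank E^{(−23)} = 1` ∧ `Ш(E^{(−23)})[5] = 0`»), and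
  `cruxBody_of_twistSelmer` — the crux's clause at the curve from ONE bound `#Sel_5(E^{(d_K)}/ℚ) ≤ 5` at the field of
  record (`−23`, `−52`, `−67`), NO rank certificate beyond the two kernel points.

CONDITIONAL on W. Zhang 2014 Lemma 8.4 (1) / Thm. 9.1, (γ) = Gross 1991 Prop. 3.7 (2) (rows only) and Stein–Wuthrich
2013 Thm. 1.1, BY NAME; per curve; nothing class-wide (the open stub (S♭) is untouched); BSD is NOT proved by any of this.

References: [SteinWuthrich2013] Thm. 1.1 (p. 1758), §12.4; [WZhang2014] Lemma 8.4 (1) (p. 236), Thm. 9.1 (p. 240);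
[GrossLMS1991] Prop. 3.7 (2); [CremonaAlgorithms1997] Table 1 (794a1, 997b1, 997c1).
-/

set_option linter.dupNamespace false

noncomputable section

open scoped Classical NumberField

namespace Summit.BirchSwinnertonDyer.BirchSwinnertonDyer.Theorems.KolyvaginDepthDoor

open Literature.NumberTheory.EllipticCurves Literature.NumberTheory.EllipticCurves.ModularForms
  WeierstrassCurve NumberField IsDedekindDomain
open Summit.BirchSwinnertonDyer.BirchSwinnertonDyer.Theorems
open Summit.BirchSwinnertonDyer.BirchSwinnertonDyer.Rank2Observatory

/-! ## Generic: the crux's clause at a ♠-cell curve from `Ш(E)[p] = 0` and ONE twist Selmer bound -/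

/-- **The clause of `KolyvaginDepthSupplyKN` at ONE curve from `Ш(E/ℚ)[p] = 0` and ONE twist `p`-Selmer bound**
(generic, W. Zhang's ♠ cell). `W` globally minimal, non-CM, `2 ≤ rank_ℤ E(ℚ)`; `p ≥ 5` good ordinary with
`ρ_{E,p^n}` onto for all `n`, `p ∤ ord_v(Δ_min)` at multiplicative `v` (Kodaira–Néron cell), ♠ (1) and ♠ (2) in
`p`-form; `K` imaginary quadratic, `d_K ∉ {−3, −4}`, `p ∤ d_K`, Heegner for `N_E`. IF `Ш(E/ℚ)[p] = 0` and
`#Sel_p(E^{(d_K)}/ℚ) ≤ p ^ rank_ℤ E(ℚ)`, THEN the crux's clause holds at `W` verbatim: W. Zhang's Lemma 8.4 (1)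
(named fact `h84`) supplies a level-one class `c_1(n) ≠ 0` with the Selmer dichotomy, and the lineage's conversion
`rankClause_of_structure_of_twistCondition` (first disjunct of the twist condition) turns it into the signed rank
clause. CONDITIONAL on `h84`; per `(E, p, K)`; BSD is not proved by it.
[cite: WZhang2014, Lemma 8.4 (1) (p. 236), Thm. 9.1 (p. 240)] -/
theorem cruxBody_of_sha_of_twistSelmer_of_lemma84
    (h84 : Literature.NumberTheory.EllipticCurves.WZhang2014_lemma84_exists_minimal_kolyvaginClass_one_selmerCard)
    (W : WeierstrassCurve ℚ) [W.IsElliptic] [W.IsGloballyMinimal] (hr : 2 ≤ W.mordellWeilRank)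
    (p : ℕ) [hp : Fact p.Prime] (h5 : 5 ≤ p) (hgood : W.HasGoodReductionAtPrime p)
    (hord : ¬ (p : ℤ) ∣ W.frobeniusTrace p)
    (htower : ∀ n : ℕ, W.HasSurjectiveModNGaloisRep (p ^ n : ℕ))
    (hKN : ∀ v : HeightOneSpectrum (𝓞 ℚ), W.HasMultiplicativeReductionAt v →
      ¬ p ∣ W.ordMinimalDiscriminant v)
    (hS1 : ∀ (ℓ : ℕ) [Fact ℓ.Prime], W.HasMultiplicativeReductionAtPrime ℓ →
      ¬ p ∣ padicValInt ℓ W.minimalDiscriminantInt)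
    (hS2 : ¬ Squarefree (W.conductorNorm ℤ) →
      (∃ (ℓ : ℕ) (_ : Fact ℓ.Prime), W.HasMultiplicativeReductionAtPrime ℓ ∧
          ¬ p ∣ padicValInt ℓ W.minimalDiscriminantInt) ∧
        ∃ (ℓ₁ ℓ₂ : ℕ) (_ : Fact ℓ₁.Prime) (_ : Fact ℓ₂.Prime), ℓ₁ ≠ ℓ₂ ∧
          W.HasMultiplicativeReductionAtPrime ℓ₁ ∧ W.HasMultiplicativeReductionAtPrime ℓ₂)
    (K : Type) [Field K] [NumberField K] (hK : IsImaginaryQuadratic K)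
    (hD3 : NumberField.discr K ≠ -3) (hD4 : NumberField.discr K ≠ -4)
    (hpD : ¬ ((p : ℤ) ∣ NumberField.discr K))
    [iNZ : NeZero (W.conductorNorm ℤ)] (hH : SatisfiesHeegnerHypothesis (W.conductorNorm ℤ) K)
    (hsha : (W.sha ⊓ AddSubgroup.torsionBy W.galH1 (p : ℤ) : AddSubgroup W.galH1) = ⊥)
    (hT : Nat.card ((W.quadraticTwist (NumberField.discr K : ℚ)).selmerGroup p) ≤ p ^ W.mordellWeilRank) :
    ∃ (p : ℕ) (hp : Fact p.Prime), 5 ≤ p ∧ W.HasGoodReductionAtPrime p ∧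
      ¬ (p : ℤ) ∣ W.frobeniusTrace p ∧ (∀ n : ℕ, W.HasSurjectiveModNGaloisRep (p ^ n : ℕ)) ∧
      (∀ v : HeightOneSpectrum (𝓞 ℚ), W.HasMultiplicativeReductionAt v →
        ¬ p ∣ W.ordMinimalDiscriminant v) ∧
      ∃ (K : Type) (_ : Field K) (_ : NumberField K), IsImaginaryQuadratic K ∧
        NumberField.discr K ≠ -3 ∧ NumberField.discr K ≠ -4 ∧
        ∃ (_ : NeZero (W.conductorNorm ℤ)), SatisfiesHeegnerHypothesis (W.conductorNorm ℤ) K ∧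
        ∃ (Dt : ModularParametrizationData W (W.conductorNorm ℤ)) (β : ℤ) (ι : K →+* ℂ) (n₁ : ℕ)
          (d : KolyvaginHeegnerData Dt β ι n₁), Squarefree n₁ ∧
          (∀ q ∈ n₁.primeFactors, Zhang2014.IsKolyvaginPrime (W.conductorNorm ℤ) W K p q) ∧
          d.kolyvaginClass hp.out 1 ≠ 0 ∧
          (n₁.primeFactors.card + 1 ≤ W.mordellWeilRank ∨
            (n₁.primeFactors.card ≤ W.mordellWeilRank ∧
              n₁.primeFactors.card + 1 ≤ (W.quadraticTwist (NumberField.discr K : ℚ)).mordellWeilRank)) := by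
  have _hr := hr
  have hsur : W.HasSurjectiveModNGaloisRep p := by simpa only [pow_one] using htower 1
  have hDN : IsCoprime (NumberField.discr K) ((W.conductorNorm ℤ : ℕ) : ℤ) := by
    rw [Int.isCoprime_iff_gcd_eq_one, Int.gcd_comm]
    exact Literature.SatisfiesHeegnerHypothesis.coprime_discr hK.1 hH
  obtain ⟨Dt, β, ι, n, d, hsupp, -, hne, -, hdich⟩ :=
    h84 W p h5 hgood hord hsur hS1 hS2 K hK hpD hDN hH
  obtain ⟨Dt', β', ι', n', d', hsupp', hne', hclause⟩ :=
    rankClause_of_structure_of_twistCondition W p hsur K ⟨Dt, β, ι, n, d, hsupp, hne, hdich⟩ hsha (Or.inl hT)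
  refine ⟨p, hp, h5, hgood, hord, htower, hKN, ?_⟩
  refine ⟨K, ‹Field K›, ‹NumberField K›, ?_⟩
  refine ⟨hK, ?_⟩
  refine ⟨hD3, ?_⟩
  refine ⟨hD4, ?_⟩
  refine ⟨iNZ, ?_⟩
  refine ⟨hH, ?_⟩
  refine ⟨Dt', β', ι', n', d', ?_⟩
  exact ⟨hsupp'.1, hsupp'.2, hne', hclause⟩

/-! ## `794a1` (`N = 794`, no 2-descent certificate; `2 ≤ rank` by `KernelCerts002.C794a1.two_le_rank`) -/

namespace C794a1

/-- **`Ш(794a1/ℚ)[5] = 0` BY NAME** (Stein–Wuthrich 2013 Thm. 1.1: non-CM `not_hasCM`, `2 ≤ rank` `KernelCerts002.C794a1.two_le_rank` — two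
kernel points, NO 2-descent certificate needed —, `N = 794 ≤ 30000` `conductorNorm_eq`, `5` good ordinary `goodOrdinary_5`,
`ρ̄_{E,5}` onto `hasSurjectiveModNGaloisRep_pow_5 1`). CONDITIONAL on that named fact; per curve; BSD is not proved by it.
[cite: SteinWuthrich2013, Thm. 1.1 (p. 1758)] [cite: CremonaAlgorithms1997, Table 1 (794a1)] -/
theorem sha_inf_torsionBy_five_eq_bot (hSW : SteinWuthrich2013_sha_inf_torsionBy_eq_bot_of_two_le_rank) :
    haveI := isElliptic_c794a1;
    haveI := isGloballyMinimal_c794a1;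
    haveI := Fact.mk (by norm_num : Nat.Prime 5);
    (((⟨1, 0, 1, -3, 2⟩ : WeierstrassCurve ℤ).map (Int.castRingHom ℚ)).sha ⊓ AddSubgroup.torsionBy ((⟨1, 0, 1, -3, 2⟩ : WeierstrassCurve ℤ).map (Int.castRingHom ℚ)).galH1 ((5 : ℕ) : ℤ) : AddSubgroup _) = ⊥ := by
  haveI := isElliptic_c794a1
  haveI := isGloballyMinimal_c794a1
  haveI := Fact.mk (by norm_num : Nat.Prime 5)
  have hsur : ((⟨1, 0, 1, -3, 2⟩ : WeierstrassCurve ℤ).map (Int.castRingHom ℚ)).HasSurjectiveModNGaloisRep (5 ^ 1 : ℕ) := hasSurjectiveModNGaloisRep_pow_5 1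
  rw [pow_one] at hsur
  exact hSW _ not_hasCM KernelCerts002.C794a1.two_le_rank (by rw [conductorNorm_eq]; norm_num) 5 (by norm_num) (by norm_num)
    goodOrdinary_5.1 goodOrdinary_5.2 hsur

/-- **DEPTH-TABLE ROW `794a1`, `(p, d_K) = (5, -23)`, v13 modulo the rank of `E` — «ONE BIT ⟺ `rank E = 2` ∧ ONE TWIST».**
For `E = 794a1` and ANY imaginary quadratic `K` with `d_K = -23`: bit `↔` «`rank_ℤ E(ℚ) = 2` ∧ `rank_ℤ E^{(-23)}(ℚ) = 1` ∧
`Ш(E^{(-23)}/ℚ)[5] = 0`» — from the v12 row `exactRowZhang_5_neg23_twoShaModRank` with its `E`-side conjunct `Ш(E)[5] = 0`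
discharged by SW Thm. 1.1; the `rank E = 2` conjunct stays (no 2-descent certificate; it drops by `and_iff_right` when the
observatory lands one). CONDITIONAL on (γ), W. Zhang L8.4 (1) / 9.1 and SW Thm. 1.1 by name; per curve; BSD is not proved by it.
[cite: SteinWuthrich2013, Thm. 1.1 (p. 1758)] [cite: WZhang2014, Lemma 8.4 (1) (p. 236), Thm. 9.1 (p. 240)] [cite: GrossLMS1991, Prop. 3.7 (2)] -/
theorem exactRowZhang_5_neg23_oneTwistModRank
    (hSW : SteinWuthrich2013_sha_inf_torsionBy_eq_bot_of_two_le_rank)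
    (h372 : GrossLMS1991.prop37_2_frobeniusCongruence)
    (h84 : Literature.NumberTheory.EllipticCurves.WZhang2014_lemma84_exists_minimal_kolyvaginClass_one_selmerCard)
    (K : Type) [Field K] [NumberField K] (hK : IsImaginaryQuadratic K)
    (hD : NumberField.discr K = -23) :
    haveI := isElliptic_c794a1;
    haveI := isGloballyMinimal_c794a1;
    haveI : NeZero (((⟨1, 0, 1, -3, 2⟩ : WeierstrassCurve ℤ).map (Int.castRingHom ℚ)).conductorNorm ℤ) := neZero_conductorNorm_of_isElliptic _;
    haveI := Fact.mk (by norm_num : Nat.Prime 5);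
    (∃ (Dt : ModularParametrizationData ((⟨1, 0, 1, -3, 2⟩ : WeierstrassCurve ℤ).map (Int.castRingHom ℚ)) (((⟨1, 0, 1, -3, 2⟩ : WeierstrassCurve ℤ).map (Int.castRingHom ℚ)).conductorNorm ℤ)) (β : ℤ)
      (ι : K →+* ℂ) (ℓ : ℕ) (d : KolyvaginHeegnerData Dt β ι ℓ),
      ℓ.Prime ∧ Zhang2014.IsKolyvaginPrime (((⟨1, 0, 1, -3, 2⟩ : WeierstrassCurve ℤ).map (Int.castRingHom ℚ)).conductorNorm ℤ) ((⟨1, 0, 1, -3, 2⟩ : WeierstrassCurve ℤ).map (Int.castRingHom ℚ)) K 5 ℓ ∧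
        d.kolyvaginClass (p := 5) (by norm_num) 1 ≠ 0) ↔
    (((⟨1, 0, 1, -3, 2⟩ : WeierstrassCurve ℤ).map (Int.castRingHom ℚ)).mordellWeilRank = 2 ∧
      (((⟨1, 0, 1, -3, 2⟩ : WeierstrassCurve ℤ).map (Int.castRingHom ℚ)).quadraticTwist (NumberField.discr K : ℚ)).mordellWeilRank = 1 ∧
      ((((⟨1, 0, 1, -3, 2⟩ : WeierstrassCurve ℤ).map (Int.castRingHom ℚ)).quadraticTwist (NumberField.discr K : ℚ)).sha ⊓
          AddSubgroup.torsionBy (((⟨1, 0, 1, -3, 2⟩ : WeierstrassCurve ℤ).map (Int.castRingHom ℚ)).quadraticTwist (NumberField.discr K : ℚ)).galH1 ((5 : ℕ) : ℤ) :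
          AddSubgroup (((⟨1, 0, 1, -3, 2⟩ : WeierstrassCurve ℤ).map (Int.castRingHom ℚ)).quadraticTwist (NumberField.discr K : ℚ)).galH1) = ⊥) := by
  haveI := isElliptic_c794a1
  haveI := isGloballyMinimal_c794a1
  haveI : NeZero (((⟨1, 0, 1, -3, 2⟩ : WeierstrassCurve ℤ).map (Int.castRingHom ℚ)).conductorNorm ℤ) := neZero_conductorNorm_of_isElliptic _
  haveI := Fact.mk (by norm_num : Nat.Prime 5)
  exact (exactRowZhang_5_neg23_twoShaModRank h372 h84 K hK hD).trans
    (and_congr_right fun _ ↦ and_iff_right (sha_inf_torsionBy_five_eq_bot hSW))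

/-- **THE CRUX `KolyvaginDepthSupplyKN` AT `794a1`, MODULO ONE RANK-ONE DATUM — NO 2-DESCENT CERTIFICATE NEEDED.**
Granted SW Thm. 1.1 and W. Zhang L8.4 (1) / 9.1 by name and, for ONE imaginary quadratic `K` with `d_K = -23` (field of
record), the bound `#Sel_5(E^{(d_K)}/ℚ) ≤ 5` on the rank-one Heegner twist, the CLAUSE of the crux holds at `W = 794a1`
verbatim (`cruxBody_of_sha_of_twistSelmer_of_lemma84` at the kernel certificates: two points `KernelCerts002.C794a1.two_le_rank`, `5` good
ordinary, `ρ_{E,5^∞}` onto, Kodaira–Néron and ♠ from `Δ(E₀) = -1588` (`spade_5`), Heegner `heegner_neg23`; `5 ≤ 5 ^ rank`).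
CONDITIONAL on the two named facts and the one twist datum; per curve; BSD is not proved by it.
[cite: SteinWuthrich2013, Thm. 1.1 (p. 1758)] [cite: WZhang2014, Lemma 8.4 (1) (p. 236), Thm. 9.1 (p. 240)] [cite: CremonaAlgorithms1997, Table 1 (794a1)] -/
theorem cruxBody_of_twistSelmer
    (hSW : SteinWuthrich2013_sha_inf_torsionBy_eq_bot_of_two_le_rank)
    (h84 : Literature.NumberTheory.EllipticCurves.WZhang2014_lemma84_exists_minimal_kolyvaginClass_one_selmerCard)
    (K : Type) [Field K] [NumberField K] (hK : IsImaginaryQuadratic K)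
    (hD : NumberField.discr K = -23)
    (hT : haveI := isElliptic_c794a1; haveI := isGloballyMinimal_c794a1;
      Nat.card ((((⟨1, 0, 1, -3, 2⟩ : WeierstrassCurve ℤ).map (Int.castRingHom ℚ)).quadraticTwist (NumberField.discr K : ℚ)).selmerGroup (5 : ℕ)) ≤ 5) :
    haveI := isElliptic_c794a1;
    haveI := isGloballyMinimal_c794a1;
    ∃ (p : ℕ) (hp : Fact p.Prime), 5 ≤ p ∧ ((⟨1, 0, 1, -3, 2⟩ : WeierstrassCurve ℤ).map (Int.castRingHom ℚ)).HasGoodReductionAtPrime p ∧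
      ¬ (p : ℤ) ∣ ((⟨1, 0, 1, -3, 2⟩ : WeierstrassCurve ℤ).map (Int.castRingHom ℚ)).frobeniusTrace p ∧ (∀ n : ℕ, ((⟨1, 0, 1, -3, 2⟩ : WeierstrassCurve ℤ).map (Int.castRingHom ℚ)).HasSurjectiveModNGaloisRep (p ^ n : ℕ)) ∧
      (∀ v : HeightOneSpectrum (𝓞 ℚ), ((⟨1, 0, 1, -3, 2⟩ : WeierstrassCurve ℤ).map (Int.castRingHom ℚ)).HasMultiplicativeReductionAt v →
        ¬ p ∣ ((⟨1, 0, 1, -3, 2⟩ : WeierstrassCurve ℤ).map (Int.castRingHom ℚ)).ordMinimalDiscriminant v) ∧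
      ∃ (K : Type) (_ : Field K) (_ : NumberField K), IsImaginaryQuadratic K ∧
        NumberField.discr K ≠ -3 ∧ NumberField.discr K ≠ -4 ∧
        ∃ (_ : NeZero (((⟨1, 0, 1, -3, 2⟩ : WeierstrassCurve ℤ).map (Int.castRingHom ℚ)).conductorNorm ℤ)), SatisfiesHeegnerHypothesis (((⟨1, 0, 1, -3, 2⟩ : WeierstrassCurve ℤ).map (Int.castRingHom ℚ)).conductorNorm ℤ) K ∧
        ∃ (Dt : ModularParametrizationData ((⟨1, 0, 1, -3, 2⟩ : WeierstrassCurve ℤ).map (Int.castRingHom ℚ)) (((⟨1, 0, 1, -3, 2⟩ : WeierstrassCurve ℤ).map (Int.castRingHom ℚ)).conductorNorm ℤ)) (β : ℤ) (ι : K →+* ℂ) (n₁ : ℕ)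
          (d : KolyvaginHeegnerData Dt β ι n₁), Squarefree n₁ ∧
          (∀ q ∈ n₁.primeFactors, Zhang2014.IsKolyvaginPrime (((⟨1, 0, 1, -3, 2⟩ : WeierstrassCurve ℤ).map (Int.castRingHom ℚ)).conductorNorm ℤ) ((⟨1, 0, 1, -3, 2⟩ : WeierstrassCurve ℤ).map (Int.castRingHom ℚ)) K p q) ∧
          d.kolyvaginClass hp.out 1 ≠ 0 ∧
          (n₁.primeFactors.card + 1 ≤ ((⟨1, 0, 1, -3, 2⟩ : WeierstrassCurve ℤ).map (Int.castRingHom ℚ)).mordellWeilRank ∨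
            (n₁.primeFactors.card ≤ ((⟨1, 0, 1, -3, 2⟩ : WeierstrassCurve ℤ).map (Int.castRingHom ℚ)).mordellWeilRank ∧
              n₁.primeFactors.card + 1 ≤ (((⟨1, 0, 1, -3, 2⟩ : WeierstrassCurve ℤ).map (Int.castRingHom ℚ)).quadraticTwist (NumberField.discr K : ℚ)).mordellWeilRank)) := by
  haveI := isElliptic_c794a1
  haveI := isGloballyMinimal_c794a1
  haveI iNZ : NeZero (((⟨1, 0, 1, -3, 2⟩ : WeierstrassCurve ℤ).map (Int.castRingHom ℚ)).conductorNorm ℤ) := neZero_conductorNorm_of_isElliptic _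
  haveI i5 := Fact.mk (by norm_num : Nat.Prime 5)
  have hsp := spade_5
  have hKN : ∀ v : HeightOneSpectrum (𝓞 ℚ), ((⟨1, 0, 1, -3, 2⟩ : WeierstrassCurve ℤ).map (Int.castRingHom ℚ)).HasMultiplicativeReductionAt v →
      ¬ 5 ∣ ((⟨1, 0, 1, -3, 2⟩ : WeierstrassCurve ℤ).map (Int.castRingHom ℚ)).ordMinimalDiscriminant v :=
    not_dvd_ordMinimalDiscriminant_of_intModel_table intModel (p := 5) (Δ₀ := -1588) (by decide +kernel)
      (B := 8) (by decide +kernel) (by decide +kernel)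
  have hS2 : ¬ Squarefree (((⟨1, 0, 1, -3, 2⟩ : WeierstrassCurve ℤ).map (Int.castRingHom ℚ)).conductorNorm ℤ) →
      (∃ (ℓ : ℕ) (_ : Fact ℓ.Prime), ((⟨1, 0, 1, -3, 2⟩ : WeierstrassCurve ℤ).map (Int.castRingHom ℚ)).HasMultiplicativeReductionAtPrime ℓ ∧
          ¬ 5 ∣ padicValInt ℓ ((⟨1, 0, 1, -3, 2⟩ : WeierstrassCurve ℤ).map (Int.castRingHom ℚ)).minimalDiscriminantInt) ∧
        ∃ (ℓ₁ ℓ₂ : ℕ) (_ : Fact ℓ₁.Prime) (_ : Fact ℓ₂.Prime), ℓ₁ ≠ ℓ₂ ∧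
          ((⟨1, 0, 1, -3, 2⟩ : WeierstrassCurve ℤ).map (Int.castRingHom ℚ)).HasMultiplicativeReductionAtPrime ℓ₁ ∧ ((⟨1, 0, 1, -3, 2⟩ : WeierstrassCurve ℤ).map (Int.castRingHom ℚ)).HasMultiplicativeReductionAtPrime ℓ₂ :=
    fun hns ↦ absurd (((⟨1, 0, 1, -3, 2⟩ : WeierstrassCurve ℤ).map (Int.castRingHom ℚ)).isSemistable_iff_squarefree_conductorNorm.mp hsp.2) hns
  have hH := satisfiesHeegnerHypothesis_conductorNorm_of_intModel intModel K hK.1 hD heegner_neg23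
  have hD3 : NumberField.discr K ≠ -3 := by rw [hD]; norm_num
  have hD4 : NumberField.discr K ≠ -4 := by rw [hD]; norm_num
  have hpD : ¬ (((5 : ℕ) : ℤ) ∣ NumberField.discr K) := by rw [hD]; norm_num
  have hr : 2 ≤ ((⟨1, 0, 1, -3, 2⟩ : WeierstrassCurve ℤ).map (Int.castRingHom ℚ)).mordellWeilRank := KernelCerts002.C794a1.two_le_rank
  have hT' : Nat.card ((((⟨1, 0, 1, -3, 2⟩ : WeierstrassCurve ℤ).map (Int.castRingHom ℚ)).quadraticTwist (NumberField.discr K : ℚ)).selmerGroup (5 : ℕ)) ≤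
      5 ^ ((⟨1, 0, 1, -3, 2⟩ : WeierstrassCurve ℤ).map (Int.castRingHom ℚ)).mordellWeilRank :=
    hT.trans (Nat.le_self_pow (by omega) 5)
  exact cruxBody_of_sha_of_twistSelmer_of_lemma84 h84 _ hr 5 (by norm_num) goodOrdinary_5.1 goodOrdinary_5.2
    hasSurjectiveModNGaloisRep_pow_5 hKN hsp.1 hS2 K hK hD3 hD4 hpD hH (sha_inf_torsionBy_five_eq_bot hSW) hT'

end C794a1

end Summit.BirchSwinnertonDyer.BirchSwinnertonDyer.Theorems.KolyvaginDepthDoor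

end
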